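import Summits.ResolutionOfSingularities.ResolutionOfSingularities.Theorems.FrobeniusLadderFInjectiveMacaulayficationGxzOffOrigin
import HarnessLib

/-!
# ROWC row F192 at `p = 5`: slicings and extracted coefficients for the CONE clause off the bad orbit
# (crux `FInjectiveMacaulayfication` stmt-ResolutionOfSingularities-15315, relative filtered engine v2; RULING R16.6 (2) of res-L1-w45a-plan-1)

Support file for crux stmt-ResolutionOfSingularities-15315 (`FrobeniusLadder.FInjectiveMacaulayfication`), chain w45a, seat
res-L1-w45a-stub-4 g6. [OURS · L1 W4.5a; templates `GxzOffOrigin` (res-L1-w45a-stub-4), `RelGddF008ConeData` (res-L1-w45a-stub-2)] —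
NOT a statement of the manuscript; AI-written, weaker than expert review.

The weighted tangent cone of F192's diagonal form along the `t`-axis is `g₀ = z² + t⁴y²w⁴ + (y² + x³)³` (`x,y,z,w,t = X₀,…,X₄`,
`φ = y² + x³`).  Off `V(x,y,z,w)` it is singular along three strata — `{x=y=z=0}` (`w,t` free), `{z=t=φ=0}`, `{z=w=φ=0}` — and F-pure
at every closed point of them EXCEPT the orbit `O = {x=y=z=t=0}` (`…RelGddF192Cone`).  The Fedder witnesses, read through slicings
(`FedderViaSlicing.clause_of_sliceCoeff` / `FedderViaSlicingNotMem.clause_of_sliceCoeff_of_not_mem`):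

* `exists_xyzSlicing5` — `k[X] ≃ k[w,t][X,Y,Z]` (slices `x,y,z`); `coeff_S1`: the `x⁰y⁴z⁴`-coefficient of `g₀⁴` is `6·(t⁴w⁴)²`;
* (plane slicing `GxzOffOrigin.exists_planeSlicing5`, slices `z,w,t`); `coeff_S2a`: the `z⁴w⁴t⁴`-coefficient is `12·y²·φ³`;
* `exists_ztSlicing5` — `k[X] ≃ k[x,w,y][Z,T]` (slices `z,t`), and (`RelGddF008ConeData.exists_xytSlicing5`, slices `z,w`);
  `coeff_S23`: the `Z⁴T⁴`-coefficient of `(Z² + C(b)T⁴ + C(c))⁴` is `12·b·c` (`b = y²w⁴`, resp. `t⁴y²`; `c = φ³`).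

All proofs are glue on Mathlib and landed files; no definitions, no named facts. [folklore]
-/

-- single-problem summit: the doubled namespace component is forced
set_option linter.dupNamespace false

noncomputable section

namespace Summit.ResolutionOfSingularities.ResolutionOfSingularities.Theorems.FInjectiveMacaulayfication.RelGddF192ConeData

open MvPolynomial IsLocalRing
open Summit.ResolutionOfSingularities.ResolutionOfSingularities.Theorems.FInjectiveMacaulayfication

/-! ## Two more slicings of `k[X₀,…,X₄]` -/

/-- **`(x,y,z)`-slicing** `k[X₀,…,X₄] ≃ k[X₃,X₄][Y₀,Y₁,Y₂]`: `X₀,X₁,X₂ ↦ Y₀,Y₁,Y₂` (slices `x,y,z`), `X₃ ↦ C X₀`, `X₄ ↦ C X₁`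
(base `k[w,t]`). [folklore] -/
theorem exists_xyzSlicing5 (k : Type) [Field k] :
    ∃ Ψ : MvPolynomial (Fin 5) k ≃+* MvPolynomial (Fin 3) (MvPolynomial (Fin 2) k),
      Ψ (X 0) = X 0 ∧ Ψ (X 1) = X 1 ∧ Ψ (X 2) = X 2 ∧ Ψ (X 3) = C (X 0) ∧ Ψ (X 4) = C (X 1) := by
  have e0 : (@finSumFinEquiv 3 2).symm 0 = Sum.inl 0 := by decide
  have e1 : (@finSumFinEquiv 3 2).symm 1 = Sum.inl 1 := by decide
  have e2 : (@finSumFinEquiv 3 2).symm 2 = Sum.inl 2 := by decide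
  have e3 : (@finSumFinEquiv 3 2).symm 3 = Sum.inr 0 := by decide
  have e4 : (@finSumFinEquiv 3 2).symm 4 = Sum.inr 1 := by decide
  refine ⟨((renameEquiv k (@finSumFinEquiv 3 2).symm).trans (sumAlgEquiv k (Fin 3) (Fin 2))).toRingEquiv, ?_, ?_, ?_, ?_, ?_⟩
  · show sumAlgEquiv k (Fin 3) (Fin 2) (rename _ (X 0)) = _
    rw [rename_X, e0]; exact sumAlgEquiv_X_inl _ _ _ _
  · show sumAlgEquiv k (Fin 3) (Fin 2) (rename _ (X 1)) = _
    rw [rename_X, e1]; exact sumAlgEquiv_X_inl _ _ _ _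
  · show sumAlgEquiv k (Fin 3) (Fin 2) (rename _ (X 2)) = _
    rw [rename_X, e2]; exact sumAlgEquiv_X_inl _ _ _ _
  · show sumAlgEquiv k (Fin 3) (Fin 2) (rename _ (X 3)) = _
    rw [rename_X, e3]; exact sumAlgEquiv_X_inr _ _ _ _
  · show sumAlgEquiv k (Fin 3) (Fin 2) (rename _ (X 4)) = _
    rw [rename_X, e4]; exact sumAlgEquiv_X_inr _ _ _ _

/-- **`(z,t)`-slicing** `k[X₀,…,X₄] ≃ k[X₀,X₃,X₁][Y₀,Y₁]`: `X₂ ↦ Y₀`, `X₄ ↦ Y₁` (slices `z,t`), `X₀ ↦ C X₀`, `X₃ ↦ C X₁`,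
`X₁ ↦ C X₂` (base `k[x,w,y]` in this order). [folklore] -/
theorem exists_ztSlicing5 (k : Type) [Field k] :
    ∃ Ψ : MvPolynomial (Fin 5) k ≃+* MvPolynomial (Fin 2) (MvPolynomial (Fin 3) k),
      Ψ (X 0) = C (X 0) ∧ Ψ (X 1) = C (X 2) ∧ Ψ (X 2) = X 0 ∧ Ψ (X 3) = C (X 1) ∧ Ψ (X 4) = X 1 := by
  have e0 : (((Equiv.swap (0 : Fin 5) 2).trans (Equiv.swap (1 : Fin 5) 4)).trans (@finSumFinEquiv 2 3).symm) 0 = Sum.inr 0 := by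
    decide
  have e1 : (((Equiv.swap (0 : Fin 5) 2).trans (Equiv.swap (1 : Fin 5) 4)).trans (@finSumFinEquiv 2 3).symm) 1 = Sum.inr 2 := by
    decide
  have e2 : (((Equiv.swap (0 : Fin 5) 2).trans (Equiv.swap (1 : Fin 5) 4)).trans (@finSumFinEquiv 2 3).symm) 2 = Sum.inl 0 := by
    decide
  have e3 : (((Equiv.swap (0 : Fin 5) 2).trans (Equiv.swap (1 : Fin 5) 4)).trans (@finSumFinEquiv 2 3).symm) 3 = Sum.inr 1 := by
    decide
  have e4 : (((Equiv.swap (0 : Fin 5) 2).trans (Equiv.swap (1 : Fin 5) 4)).trans (@finSumFinEquiv 2 3).symm) 4 = Sum.inl 1 := by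
    decide
  refine ⟨((renameEquiv k (((Equiv.swap (0 : Fin 5) 2).trans (Equiv.swap (1 : Fin 5) 4)).trans (@finSumFinEquiv 2 3).symm)).trans
    (sumAlgEquiv k (Fin 2) (Fin 3))).toRingEquiv, ?_, ?_, ?_, ?_, ?_⟩
  · show sumAlgEquiv k (Fin 2) (Fin 3) (rename _ (X 0)) = _
    rw [rename_X, e0]; exact sumAlgEquiv_X_inr _ _ _ _
  · show sumAlgEquiv k (Fin 2) (Fin 3) (rename _ (X 1)) = _
    rw [rename_X, e1]; exact sumAlgEquiv_X_inr _ _ _ _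
  · show sumAlgEquiv k (Fin 2) (Fin 3) (rename _ (X 2)) = _
    rw [rename_X, e2]; exact sumAlgEquiv_X_inl _ _ _ _
  · show sumAlgEquiv k (Fin 2) (Fin 3) (rename _ (X 3)) = _
    rw [rename_X, e3]; exact sumAlgEquiv_X_inr _ _ _ _
  · show sumAlgEquiv k (Fin 2) (Fin 3) (rename _ (X 4)) = _
    rw [rename_X, e4]; exact sumAlgEquiv_X_inl _ _ _ _

/-! ## The extracted coefficients of `g₀⁴` -/

/-- **Stratum `{x=y=z=0}`: the `x⁰y⁴z⁴`-coefficient of `g₀⁴` is `6·a²`, `a = t⁴w⁴`.**  In `k[w,t][X,Y,Z]` with `G = Z² + u`,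
`u = C(a)Y² + (Y² + X³)³`: binomial in `Z` (`C(4,2) = 6`), kill `X`, and `(C(a)Y² + Y⁶)² = C(a²)Y⁴ + Y⁵·(…)`. [folklore] -/
theorem coeff_S1 (k : Type) [Field k] (a : MvPolynomial (Fin 2) k) :
    coeff (Finsupp.single (2 : Fin 3) (2 * 2) + Finsupp.single 1 4)
      ((X 2 ^ 2 + (C a * X 1 ^ 2 + (X 1 ^ 2 + X 0 ^ 3) ^ 3) : MvPolynomial (Fin 3) (MvPolynomial (Fin 2) k)) ^ 4) =
        6 * a ^ 2 := by
  set u : MvPolynomial (Fin 3) (MvPolynomial (Fin 2) k) := C a * X 1 ^ 2 + (X 1 ^ 2 + X 0 ^ 3) ^ 3 with hu_def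
  have hφdeg : degreeOf 2 (X 1 ^ 2 + X 0 ^ 3 : MvPolynomial (Fin 3) (MvPolynomial (Fin 2) k)) = 0 := by
    apply Nat.eq_zero_of_le_zero
    refine (degreeOf_add_le _ _ _).trans (max_le ?_ ?_) <;>
    · refine (degreeOf_pow_le _ _ _).trans ?_
      rw [degreeOf_X, if_neg (by decide), mul_zero]
  have hu : degreeOf 2 u = 0 := by
    apply Nat.eq_zero_of_le_zero
    refine (degreeOf_add_le _ _ _).trans (max_le ?_ ?_)
    · refine (degreeOf_mul_le _ _ _).trans ?_
      rw [degreeOf_C, zero_add]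
      refine (degreeOf_pow_le _ _ _).trans ?_
      rw [degreeOf_X, if_neg (by decide), mul_zero]
    · refine (degreeOf_pow_le _ _ _).trans ?_
      rw [hφdeg, mul_zero]
  rw [FedderViaSlicing.coeff_X_pow_add_pow 2 2 4 2 (by norm_num) (by norm_num) u hu _ (by simp),
    show (4 - 2 : ℕ) = 2 from rfl, show (Nat.choose 4 2 : MvPolynomial (Fin 2) k) = 6 by norm_num [Nat.choose]]
  congr 1
  -- kill `X` (`Y₀`), then `Y⁵`
  have hdvd : (X 0 : MvPolynomial (Fin 3) (MvPolynomial (Fin 2) k)) ^ 1 ∣ u - (C a * X 1 ^ 2 + X 1 ^ 6) :=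
    ⟨X 0 ^ 2 * (3 * X 1 ^ 4 + 3 * X 1 ^ 2 * X 0 ^ 3 + X 0 ^ 6), by rw [hu_def]; ring⟩
  rw [T4PlusFedderData.coeff_pow_eq_of_X_pow_dvd_sub (Finsupp.single 1 4) 0 1 (by simp) hdvd 2]
  have hsq : ((C a * X 1 ^ 2 + X 1 ^ 6) ^ 2 : MvPolynomial (Fin 3) (MvPolynomial (Fin 2) k)) =
      C (a ^ 2) * X 1 ^ 4 + X 1 ^ 5 * (2 * C a * X 1 ^ 3 + X 1 ^ 7) := by
    rw [map_pow]; ring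
  rw [hsq, coeff_add, HFedderCertificates.coeff_X_pow_mul_eq_zero _ 1 5 (by simp), add_zero, X_pow_eq_monomial, coeff_C_mul,
    coeff_monomial, if_pos rfl, mul_one]

/-- **Strata `{z=t=φ=0}` with `w ∈ Q` too: the `z⁴w⁴t⁴`-coefficient of `g₀⁴` is `12·b·c`, `b = y²`, `c = φ³`.**  In
`k[x,y][Z,W,T]` with `G = Z² + u`, `u = C(b)T⁴W⁴ + C(c)`: binomial in `Z`, then `u² = C(b²)T⁸W⁸ + C(2bc)T⁴W⁴ + C(c²)`. [folklore] -/
theorem coeff_S2a (k : Type) [Field k] (b c : MvPolynomial (Fin 2) k) :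
    coeff (Finsupp.single (0 : Fin 3) (2 * 2) + (Finsupp.single 2 4 + Finsupp.single 1 4))
      ((X 0 ^ 2 + (C b * X 2 ^ 4 * X 1 ^ 4 + C c) : MvPolynomial (Fin 3) (MvPolynomial (Fin 2) k)) ^ 4) =
        6 * (2 * b * c) := by
  set u : MvPolynomial (Fin 3) (MvPolynomial (Fin 2) k) := C b * X 2 ^ 4 * X 1 ^ 4 + C c with hu_def
  have hu : degreeOf 0 u = 0 := by
    apply Nat.eq_zero_of_le_zero
    refine (degreeOf_add_le _ _ _).trans (max_le ?_ ?_)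
    · have h1 : degreeOf 0 (C b * X 2 ^ 4 : MvPolynomial (Fin 3) (MvPolynomial (Fin 2) k)) = 0 := by
        apply Nat.eq_zero_of_le_zero
        refine (degreeOf_mul_le _ _ _).trans ?_
        rw [degreeOf_C, zero_add]
        refine (degreeOf_pow_le _ _ _).trans ?_
        rw [degreeOf_X, if_neg (by decide), mul_zero]
      have h2 : degreeOf 0 (X 1 ^ 4 : MvPolynomial (Fin 3) (MvPolynomial (Fin 2) k)) = 0 := by
        apply Nat.eq_zero_of_le_zero
        refine (degreeOf_pow_le _ _ _).trans ?_
        rw [degreeOf_X, if_neg (by decide), mul_zero]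
      refine (degreeOf_mul_le _ _ _).trans ?_
      rw [h1, h2]
    · rw [degreeOf_C]
  rw [FedderViaSlicing.coeff_X_pow_add_pow 0 2 4 2 (by norm_num) (by norm_num) u hu _ (by simp),
    show (4 - 2 : ℕ) = 2 from rfl, show (Nat.choose 4 2 : MvPolynomial (Fin 2) k) = 6 by norm_num [Nat.choose]]
  congr 1
  have hsq : (u ^ 2 : MvPolynomial (Fin 3) (MvPolynomial (Fin 2) k)) =
      X 2 ^ 5 * (C (b ^ 2) * X 2 ^ 3 * X 1 ^ 8) + C (2 * b * c) * (X 2 ^ 4 * X 1 ^ 4) + C (c ^ 2) := by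
    rw [hu_def, map_pow, map_pow, map_mul, map_mul, map_ofNat]; ring
  have hmono : (X 2 ^ 4 * X 1 ^ 4 : MvPolynomial (Fin 3) (MvPolynomial (Fin 2) k)) =
      monomial (Finsupp.single 2 4 + Finsupp.single 1 4) 1 := by
    rw [X_pow_eq_monomial, X_pow_eq_monomial, monomial_mul, one_mul]
  rw [hsq, coeff_add, coeff_add, HFedderCertificates.coeff_X_pow_mul_eq_zero _ 2 5 (by simp), zero_add, hmono,
    coeff_C_mul, coeff_monomial, if_pos rfl, mul_one, coeff_C, if_neg, add_zero]
  intro h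
  have h2 := Finsupp.ext_iff.mp h 2
  simp at h2

/-- **Strata `{z=t=φ=0}` (`w ∉ Q`) and `{z=w=φ=0}` (`t ∉ Q`): the `Z⁴Y⁴`-coefficient of `(Z² + C(b)Y⁴ + C(c))⁴` is `12·b·c`**
(`Y = t`, `b = y²w⁴`, resp. `Y = w`, `b = t⁴y²`; `c = φ³`; base `k[x,y,w]` resp. `k[x,y,t]`). [folklore] -/
theorem coeff_S23 (k : Type) [Field k] (b c : MvPolynomial (Fin 3) k) :
    coeff (Finsupp.single (0 : Fin 2) (2 * 2) + Finsupp.single 1 4)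
      ((X 0 ^ 2 + (C b * X 1 ^ 4 + C c) : MvPolynomial (Fin 2) (MvPolynomial (Fin 3) k)) ^ 4) =
        6 * (2 * b * c) := by
  set u : MvPolynomial (Fin 2) (MvPolynomial (Fin 3) k) := C b * X 1 ^ 4 + C c with hu_def
  have hu : degreeOf 0 u = 0 := by
    apply Nat.eq_zero_of_le_zero
    refine (degreeOf_add_le _ _ _).trans (max_le ?_ ?_)
    · refine (degreeOf_mul_le _ _ _).trans ?_
      rw [degreeOf_C, zero_add]
      refine (degreeOf_pow_le _ _ _).trans ?_
      rw [degreeOf_X, if_neg (by decide), mul_zero]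
    · rw [degreeOf_C]
  rw [FedderViaSlicing.coeff_X_pow_add_pow 0 2 4 2 (by norm_num) (by norm_num) u hu _ (by simp),
    show (4 - 2 : ℕ) = 2 from rfl, show (Nat.choose 4 2 : MvPolynomial (Fin 3) k) = 6 by norm_num [Nat.choose]]
  congr 1
  have hsq : (u ^ 2 : MvPolynomial (Fin 2) (MvPolynomial (Fin 3) k)) =
      X 1 ^ 5 * (C (b ^ 2) * X 1 ^ 3) + C (2 * b * c) * X 1 ^ 4 + C (c ^ 2) := by
    rw [hu_def, map_pow, map_pow, map_mul, map_mul, map_ofNat]; ring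
  rw [hsq, coeff_add, coeff_add, HFedderCertificates.coeff_X_pow_mul_eq_zero _ 1 5 (by simp), zero_add, X_pow_eq_monomial,
    coeff_C_mul, coeff_monomial, if_pos rfl, mul_one, coeff_C, if_neg, add_zero]
  rw [eq_comm, Finsupp.single_eq_zero]
  norm_num

end Summit.ResolutionOfSingularities.ResolutionOfSingularities.Theorems.FInjectiveMacaulayfication.RelGddF192ConeData

end
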